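import Summits.QuantumFields.YangMills.Theorems.UnitScaleTiltHalvingDbarLipschitzCore
import HarnessLib

/-!
# Line H (`BirthV10.stub_halvingStep`, stmt-QuantumFields-19200) — LEMMA B-al-2, brick (B-iii): ★ THE TORUS DOUBLE BAR IS LIPSCHITZ IN THE FIELD ON THE TWO
# BLOCKS, WITH CONSTANT THE NUMBER OF BONDS IT READS ([Balaban1985Averaging] (89), [Balaban1987RG1] (0.4))

Cell `ym3-torus` (HUMAN RULING D-0037: YM₃ on T³ is ladder rung R3 — NOT d = 4, NOT infinite volume, NOT a mass gap, NOT the Clay problem), width seat `ym-ust-19200-w3` gen 10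
(LEAD-H ★w5-19200 g7 WORD 10 (2): LEMMA B-al ≡ (N1); SIGNATURE B-al-2 v1 cea012fa, brick (B-iii)).  `--supports stmt-QuantumFields-19200 --as helper`; THEOREMS ONLY (0 `def`,
0 `sorry`); count-neutral; nothing here claims B-al-2, `H42topCrossT`, (M2′), the stub, the crux or the gap.

WHAT.  For two `𝔸ˣ`-fields `W, W′` on `T^{(j)}` that are `s`-close to `1` and `ρ`-close to EACH OTHER on the bonds of the two blocks of the coarse bond `c`:
(core half — transports and `eml` Lipschitz, generic algebra — in ✓`UnitScaleTiltHalvingDbarLipschitzCore`)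
* ★ `norm_dbarAvgU_inv_mul_sub_one_le` — **`‖(U̿(W)(c))⁻¹·U̿(W′)(c) − 1‖ ≤ 2·(ℓ + L + 2m)·ρ`**, `ℓ = (d+2)L` (loop length bound ✓`length_loopWord_le`), `m = d·⌊(L−1)∕2⌋`
  (centre-stair length bound ✓`length_stairWord_le`), under `10⁴·ℓ·s ≤ 1`, `ρ ≤ s`: the (89) double bar `v(c₋)⁻¹·eml{loops}·W(straight)·v(c₊)` reads `≤ ℓ` bonds per loop,
  `L` on the axis and `≤ m` per frame stair, and each reading is `ρ`-Lipschitz.  This is the amplification factor `A = 2(ℓ + L + 2m)` of B-al-2's level recursion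
  `ρ_{j+1} ≤ A·ρ_j + c₁(Lδ′_j)²` (`A = 48 < L⁴ = 81` at `d = L = 3`).
HONEST SCOPE.  A Lipschitz estimate for the one-step map; nothing of the level induction is here.

References: T. Bałaban, CMP **98** (1985) 17–51 [Balaban1985Averaging] ((62) p.28, (89) p.31, Prop. 3 (122)–(125) p.36); CMP **109** (1987) 249–301 [Balaban1987RG1]
((0.3)–(0.4) pp.252–253).
-/

set_option autoImplicit false

noncomputable section

open scoped BigOperators
open NormedSpace

namespace Summit.QuantumFields.YangMills.Theorems.HalvingDbarLipschitz

open Literature.MathematicalPhysics.QuantumFieldTheory.Balaban1983to89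
open T4Continuum BlockAveraging AveragingRT ExpMeanLog MatrixLog BlockAveragingEMLLinearised
open B10Eq27TorusAxialLog (holT holT_nil holT_cons_true holT_cons_false)
open B7TransferAnalyticMean (meanCLM meanCLM_apply norm_meanCLM_apply_le)
open BlockAveragingEMLAnalyticMean (norm_fderiv_eml_sub_mean_le isAnalyticMean_eml)
open T4Continuum (blockOf_ends_of_mem_stairWalk)
open LatticeWordStokes (length_loopWord_le length_stairWord_le)
open Summit.QuantumFields.YangMills.Theorems.Prop8Chart (loopHolU emlAvgU coe_emlAvgU norm_holT_sub_one_sub_walkSum_le_of_steps norm_holT_sub_one_sub_walkSum_le_of_length_le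
  norm_inv_sub_one_le_two_mul two_block_of_mem_loopWalk two_block_of_mem_lineWalk norm_loopHolU_sub_one_le)
open Summit.QuantumFields.YangMills.Theorems.Prop8ChartDoubleBar (vframeU dbarAvgU coe_dbarAvgU coe_vframeU norm_vframeU_sub_one_le norm_dbarAvgU_sub_one_le norm_holT_stair_sub_one_le)
open HalvingDbarLipschitzCore

variable {P : Params} {j : ℕ}
variable {𝔸 : Type*} [NormedRing 𝔸] [NormedAlgebra ℂ 𝔸] [CompleteSpace 𝔸] [NormOneClass 𝔸]

/-! ## The double bar (89) is Lipschitz in the field on the two blocks -/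

section DoubleBar

/-- The length slack at the scale `ℓ = (d+2)L`: `n ≤ ℓ` and `10⁴ℓs ≤ 1` give `(n+1)·2s ≤ 10⁻³`. [folklore] -/
theorem length_slack {s : ℝ} (hs0 : 0 ≤ s) (hℓs : 10000 * (((P.d + 2) * P.L : ℕ) : ℝ) * s ≤ 1) {n : ℕ} (hn : n ≤ (P.d + 2) * P.L) :
    ((n + 1 : ℕ) : ℝ) * (2 * s) ≤ 1 / 1000 := by
  have hℓ1 : 1 ≤ (P.d + 2) * P.L := Nat.one_le_iff_ne_zero.mpr (Nat.mul_ne_zero (by omega) (by have := P.hL.2; omega))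
  have h2 : ((n + 1 : ℕ) : ℝ) ≤ 2 * (((P.d + 2) * P.L : ℕ) : ℝ) := by
    have h1 : (n : ℝ) ≤ (((P.d + 2) * P.L : ℕ) : ℝ) := by exact_mod_cast hn
    have h1' : (1 : ℝ) ≤ (((P.d + 2) * P.L : ℕ) : ℝ) := by exact_mod_cast hℓ1
    have e : ((n + 1 : ℕ) : ℝ) = (n : ℝ) + 1 := by push_cast; ring
    rw [e]; linarith
  calc ((n + 1 : ℕ) : ℝ) * (2 * s) ≤ (2 * (((P.d + 2) * P.L : ℕ) : ℝ)) * (2 * s) := by gcongr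
    _ = 4 * ((((P.d + 2) * P.L : ℕ) : ℝ) * s) := by ring
    _ ≤ 1 / 1000 := by nlinarith [mul_nonneg (Nat.cast_nonneg ((P.d + 2) * P.L)) hs0]

/-- **FRAMES.**  Within a block `y`: if `‖W(b) − 1‖, ‖W′(b) − 1‖ ≤ s` and `‖W′(b) − W(b)‖ ≤ ρ` on the bonds of `B(y)` and `10⁴ℓs ≤ 1`, then the frames differ by
`≤ (112∕100)·m·ρ`, `m = d·⌊(L−1)∕2⌋` (centre stairs have `≤ m` steps; `eml` is `106∕100`-Lipschitz there). [cite: Balaban1985Averaging, (62) p.28, (110) p.34] -/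
theorem norm_vframeU_sub_vframeU_le (hj : j + 1 ≤ P.m + P.K) {W W' : GaugeField P j 𝔸ˣ} (y : Site P (j + 1)) {s ρ : ℝ}
    (hs0 : 0 ≤ s) (hρ0 : 0 ≤ ρ) (hℓs : 10000 * (((P.d + 2) * P.L : ℕ) : ℝ) * s ≤ 1)
    (hW : ∀ b : PBond P j, blockOf b.src = y → blockOf b.tgt = y → ‖((W b : 𝔸ˣ) : 𝔸) - 1‖ ≤ s)
    (hW' : ∀ b : PBond P j, blockOf b.src = y → blockOf b.tgt = y → ‖((W' b : 𝔸ˣ) : 𝔸) - 1‖ ≤ s)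
    (hd : ∀ b : PBond P j, blockOf b.src = y → blockOf b.tgt = y → ‖((W' b : 𝔸ˣ) : 𝔸) - W b‖ ≤ ρ) :
    ‖((vframeU W' y : 𝔸ˣ) : 𝔸) - vframeU W y‖ ≤ 112 / 100 * ((P.d * ((P.L - 1) / 2) : ℕ) : ℝ) * ρ := by
  set ℓ : ℝ := (((P.d + 2) * P.L : ℕ) : ℝ) with hℓ
  set m : ℝ := ((P.d * ((P.L - 1) / 2) : ℕ) : ℝ) with hm
  have hℓ0 : 0 ≤ ℓ := Nat.cast_nonneg _
  have hm0 : 0 ≤ m := Nat.cast_nonneg _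
  have hs2 : s ≤ 1 / 2 := by
    have hℓ1 : (1 : ℝ) ≤ ℓ := by
      rw [hℓ]; exact_mod_cast Nat.one_le_iff_ne_zero.mpr (Nat.mul_ne_zero (by omega) (by have := P.hL.2; omega))
    nlinarith
  have h4 : 4 * ℓ * s ≤ 1 := by nlinarith [mul_nonneg hℓ0 hs0]
  have hmℓn : P.d * ((P.L - 1) / 2) ≤ (P.d + 2) * P.L :=
    calc P.d * ((P.L - 1) / 2) ≤ P.d * P.L := Nat.mul_le_mul_left _ (by omega)
      _ ≤ (P.d + 2) * P.L := Nat.mul_le_mul_right _ (by omega)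
  -- stairs
  have hstair : ∀ i : Idx P,
      ‖((holT W' (emb y) (stairWord i.2.1 (off i.1)) : 𝔸ˣ) : 𝔸) - holT W (emb y) (stairWord i.2.1 (off i.1))‖ ≤ 21 / 20 * m * ρ := fun i => by
    have hlen : (stairWord i.2.1 (off i.1)).length ≤ P.d * ((P.L - 1) / 2) :=
      length_stairWord_le i.2.1 (off i.1) _ fun ν => by have h := off_bounds i.1 ν; omega
    have h := norm_holT_sub_holT_le_of_length_le (W := W) (W' := W') hs0 hs2 hρ0 _ (emb y) hlen fun st hst =>
      ⟨hW st.bond (blockOf_ends_of_mem_stairWalk hj y i.1 i.2.1 st hst).1 (blockOf_ends_of_mem_stairWalk hj y i.1 i.2.1 st hst).2,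
        hW' st.bond (blockOf_ends_of_mem_stairWalk hj y i.1 i.2.1 st hst).1 (blockOf_ends_of_mem_stairWalk hj y i.1 i.2.1 st hst).2,
        hd st.bond (blockOf_ends_of_mem_stairWalk hj y i.1 i.2.1 st hst).1 (blockOf_ends_of_mem_stairWalk hj y i.1 i.2.1 st hst).2⟩
    refine h.trans ?_
    have hp := one_add_two_mul_pow_le hs0 (length_slack hs0 hℓs hmℓn)
    calc (m : ℝ) * ((1 + 2 * s) ^ (P.d * ((P.L - 1) / 2) + 1) * ρ) = (1 + 2 * s) ^ (P.d * ((P.L - 1) / 2) + 1) * (m * ρ) := by ring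
      _ ≤ 21 / 20 * (m * ρ) := mul_le_mul_of_nonneg_right hp (mul_nonneg hm0 hρ0)
      _ = 21 / 20 * m * ρ := by ring
  -- the stair families and the Lipschitz `eml`
  have ht : ∀ (V : GaugeField P j 𝔸ˣ), (∀ b : PBond P j, blockOf b.src = y → blockOf b.tgt = y → ‖((V b : 𝔸ˣ) : 𝔸) - 1‖ ≤ s) →
      ‖(fun i : Idx P => ((holT V (emb y) (stairWord i.2.1 (off i.1)) : 𝔸ˣ) : 𝔸)) - 1‖ ≤ 4 * ℓ * s := fun V hV => by
    refine (pi_norm_le_iff_of_nonneg (by positivity)).mpr fun i => ?_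
    rw [Pi.sub_apply, Pi.one_apply]
    exact (norm_holT_stair_sub_one_le hj y hs0 h4 hV i).1
  have hdiff : ‖(fun i : Idx P => ((holT W' (emb y) (stairWord i.2.1 (off i.1)) : 𝔸ˣ) : 𝔸)) -
      (fun i : Idx P => ((holT W (emb y) (stairWord i.2.1 (off i.1)) : 𝔸ˣ) : 𝔸))‖ ≤ 21 / 20 * m * ρ :=
    (pi_norm_le_iff_of_nonneg (by positivity)).mpr fun i => by rw [Pi.sub_apply]; exact hstair i
  rw [coe_vframeU, coe_vframeU]
  refine (norm_eml_sub_eml_le (ht W hW) (ht W' hW') (by nlinarith [mul_nonneg hℓ0 hs0])).trans ?_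
  have hc : 1 + 144 * (4 * ℓ * s) ≤ 106 / 100 := by nlinarith [mul_nonneg hℓ0 hs0]
  calc (1 + 144 * (4 * ℓ * s)) * _ ≤ (106 / 100) * (21 / 20 * m * ρ) := by gcongr
    _ ≤ 112 / 100 * m * ρ := by nlinarith [mul_nonneg hm0 hρ0]

/-- **LOOPS.**  On the two blocks of `c`: the `eml` of the (0.4) loop family moves by `≤ (112∕100)·ℓ·ρ` (loops have `≤ ℓ = (d+2)L` steps). [cite: Balaban1987RG1, (0.4) p.253] -/
theorem norm_eml_loopHolU_sub_le (hj : j + 1 ≤ P.m + P.K) {W W' : GaugeField P j 𝔸ˣ} (c : PBond P (j + 1)) {s ρ : ℝ}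
    (hs0 : 0 ≤ s) (hρ0 : 0 ≤ ρ) (hℓs : 10000 * (((P.d + 2) * P.L : ℕ) : ℝ) * s ≤ 1)
    (hW : ∀ b : PBond P j, (blockOf b.src = c.src ∨ blockOf b.src = c.tgt) → (blockOf b.tgt = c.src ∨ blockOf b.tgt = c.tgt) →
      ‖((W b : 𝔸ˣ) : 𝔸) - 1‖ ≤ s)
    (hW' : ∀ b : PBond P j, (blockOf b.src = c.src ∨ blockOf b.src = c.tgt) → (blockOf b.tgt = c.src ∨ blockOf b.tgt = c.tgt) →
      ‖((W' b : 𝔸ˣ) : 𝔸) - 1‖ ≤ s)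
    (hd : ∀ b : PBond P j, (blockOf b.src = c.src ∨ blockOf b.src = c.tgt) → (blockOf b.tgt = c.src ∨ blockOf b.tgt = c.tgt) →
      ‖((W' b : 𝔸ˣ) : 𝔸) - W b‖ ≤ ρ) :
    ‖eml (fun i : Idx P => ((loopHolU W' c i : 𝔸ˣ) : 𝔸)) - eml (fun i : Idx P => ((loopHolU W c i : 𝔸ˣ) : 𝔸))‖ ≤
      112 / 100 * (((P.d + 2) * P.L : ℕ) : ℝ) * ρ := by
  set ℓ : ℝ := (((P.d + 2) * P.L : ℕ) : ℝ) with hℓ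
  have hℓ0 : 0 ≤ ℓ := Nat.cast_nonneg _
  have hs2 : s ≤ 1 / 2 := by
    have hℓ1 : (1 : ℝ) ≤ ℓ := by
      rw [hℓ]; exact_mod_cast Nat.one_le_iff_ne_zero.mpr (Nat.mul_ne_zero (by omega) (by have := P.hL.2; omega))
    nlinarith
  have h4 : 4 * ℓ * s ≤ 1 := by nlinarith [mul_nonneg hℓ0 hs0]
  have hloop : ∀ i : Idx P, ‖((loopHolU W' c i : 𝔸ˣ) : 𝔸) - loopHolU W c i‖ ≤ 21 / 20 * ℓ * ρ := fun i => by
    have h := norm_holT_sub_holT_le_of_length_le (W := W) (W' := W') hs0 hs2 hρ0 _ (emb c.src) (length_loopWord_le c i) fun st hst =>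
      ⟨hW st.bond (two_block_of_mem_loopWalk hj c i hst).1 (two_block_of_mem_loopWalk hj c i hst).2,
        hW' st.bond (two_block_of_mem_loopWalk hj c i hst).1 (two_block_of_mem_loopWalk hj c i hst).2,
        hd st.bond (two_block_of_mem_loopWalk hj c i hst).1 (two_block_of_mem_loopWalk hj c i hst).2⟩
    refine h.trans ?_
    have hp := one_add_two_mul_pow_le hs0 (length_slack hs0 hℓs le_rfl)
    calc (ℓ : ℝ) * ((1 + 2 * s) ^ ((P.d + 2) * P.L + 1) * ρ) = (1 + 2 * s) ^ ((P.d + 2) * P.L + 1) * (ℓ * ρ) := by ring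
      _ ≤ 21 / 20 * (ℓ * ρ) := mul_le_mul_of_nonneg_right hp (mul_nonneg hℓ0 hρ0)
      _ = 21 / 20 * ℓ * ρ := by ring
  have ht : ∀ (V : GaugeField P j 𝔸ˣ), (∀ b : PBond P j, (blockOf b.src = c.src ∨ blockOf b.src = c.tgt) → (blockOf b.tgt = c.src ∨ blockOf b.tgt = c.tgt) →
      ‖((V b : 𝔸ˣ) : 𝔸) - 1‖ ≤ s) → ‖(fun i : Idx P => ((loopHolU V c i : 𝔸ˣ) : 𝔸)) - 1‖ ≤ 4 * ℓ * s := fun V hV => by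
    refine (pi_norm_le_iff_of_nonneg (by positivity)).mpr fun i => ?_
    rw [Pi.sub_apply, Pi.one_apply]
    exact (norm_loopHolU_sub_one_le hj c hs0 h4 hV i).1
  have hdiff : ‖(fun i : Idx P => ((loopHolU W' c i : 𝔸ˣ) : 𝔸)) - (fun i : Idx P => ((loopHolU W c i : 𝔸ˣ) : 𝔸))‖ ≤ 21 / 20 * ℓ * ρ :=
    (pi_norm_le_iff_of_nonneg (by positivity)).mpr fun i => by rw [Pi.sub_apply]; exact hloop i
  refine (norm_eml_sub_eml_le (ht W hW) (ht W' hW') (by nlinarith [mul_nonneg hℓ0 hs0])).trans ?_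
  have hc : 1 + 144 * (4 * ℓ * s) ≤ 106 / 100 := by nlinarith [mul_nonneg hℓ0 hs0]
  calc (1 + 144 * (4 * ℓ * s)) * _ ≤ (106 / 100) * (21 / 20 * ℓ * ρ) := by gcongr
    _ ≤ 112 / 100 * ℓ * ρ := by nlinarith [mul_nonneg hℓ0 hρ0]

omit [NormedAlgebra ℂ 𝔸] [CompleteSpace 𝔸] in
/-- **THE AXIS.**  The straight `L`-step transporters from the block centre differ by `≤ (21∕20)·L·ρ`. [cite: Balaban1987RG1, (0.4) p.253] -/
theorem norm_holT_line_sub_le (hj : j + 1 ≤ P.m + P.K) {W W' : GaugeField P j 𝔸ˣ} (c : PBond P (j + 1)) {s ρ : ℝ}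
    (hs0 : 0 ≤ s) (hρ0 : 0 ≤ ρ) (hℓs : 10000 * (((P.d + 2) * P.L : ℕ) : ℝ) * s ≤ 1)
    (hW : ∀ b : PBond P j, (blockOf b.src = c.src ∨ blockOf b.src = c.tgt) → (blockOf b.tgt = c.src ∨ blockOf b.tgt = c.tgt) →
      ‖((W b : 𝔸ˣ) : 𝔸) - 1‖ ≤ s)
    (hW' : ∀ b : PBond P j, (blockOf b.src = c.src ∨ blockOf b.src = c.tgt) → (blockOf b.tgt = c.src ∨ blockOf b.tgt = c.tgt) →
      ‖((W' b : 𝔸ˣ) : 𝔸) - 1‖ ≤ s)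
    (hd : ∀ b : PBond P j, (blockOf b.src = c.src ∨ blockOf b.src = c.tgt) → (blockOf b.tgt = c.src ∨ blockOf b.tgt = c.tgt) →
      ‖((W' b : 𝔸ˣ) : 𝔸) - W b‖ ≤ ρ) :
    ‖((holT W' (emb c.src) (List.replicate P.L (c.dir, true)) : 𝔸ˣ) : 𝔸) - holT W (emb c.src) (List.replicate P.L (c.dir, true))‖ ≤ 21 / 20 * P.L * ρ := by
  have hℓ0 : (0 : ℝ) ≤ (((P.d + 2) * P.L : ℕ) : ℝ) := Nat.cast_nonneg _
  have hs2 : s ≤ 1 / 2 := by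
    have hℓ1 : (1 : ℝ) ≤ (((P.d + 2) * P.L : ℕ) : ℝ) := by
      exact_mod_cast Nat.one_le_iff_ne_zero.mpr (Nat.mul_ne_zero (by omega) (by have := P.hL.2; omega))
    nlinarith
  have hLℓn : P.L ≤ (P.d + 2) * P.L := by nlinarith
  have h := norm_holT_sub_holT_le (W := W) (W' := W') hs0 hs2 hρ0 (List.replicate P.L (c.dir, true)) (emb c.src) fun st hst =>
    ⟨hW st.bond (two_block_of_mem_lineWalk hj c hst).1 (two_block_of_mem_lineWalk hj c hst).2,
      hW' st.bond (two_block_of_mem_lineWalk hj c hst).1 (two_block_of_mem_lineWalk hj c hst).2,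
      hd st.bond (two_block_of_mem_lineWalk hj c hst).1 (two_block_of_mem_lineWalk hj c hst).2⟩
  rw [List.length_replicate] at h
  refine h.trans ?_
  have hp := one_add_two_mul_pow_le hs0 (length_slack hs0 hℓs hLℓn)
  calc (P.L : ℝ) * ((1 + 2 * s) ^ (P.L + 1) * ρ) = (1 + 2 * s) ^ (P.L + 1) * (P.L * ρ) := by ring
    _ ≤ 21 / 20 * (P.L * ρ) := mul_le_mul_of_nonneg_right hp (mul_nonneg (Nat.cast_nonneg _) hρ0)
    _ = 21 / 20 * P.L * ρ := by ring

/-- **SIZES.**  If `‖W(b) − 1‖ ≤ s` on the two blocks of `c` and `10⁴ℓs ≤ 1`, every factor the double bar (89) is built from — the inverse frame at `c₋`, the frame at `c₊`,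
the `eml` of the loops, the axis transporter, their product — and the inverse of the double bar itself have norm `≤ 101∕100`.
[cite: Balaban1985Averaging, (62) p.28, (89) p.31, (122)-(125) p.36] -/
theorem norm_dbar_factors_le (hj : j + 1 ≤ P.m + P.K) {W : GaugeField P j 𝔸ˣ} (c : PBond P (j + 1)) {s : ℝ}
    (hs0 : 0 ≤ s) (hℓs : 10000 * (((P.d + 2) * P.L : ℕ) : ℝ) * s ≤ 1)
    (hW : ∀ b : PBond P j, (blockOf b.src = c.src ∨ blockOf b.src = c.tgt) → (blockOf b.tgt = c.src ∨ blockOf b.tgt = c.tgt) →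
      ‖((W b : 𝔸ˣ) : 𝔸) - 1‖ ≤ s) :
    ‖(((vframeU W c.src)⁻¹ : 𝔸ˣ) : 𝔸)‖ ≤ 101 / 100 ∧ ‖((vframeU W c.tgt : 𝔸ˣ) : 𝔸)‖ ≤ 101 / 100 ∧
      ‖eml (fun i : Idx P => ((loopHolU W c i : 𝔸ˣ) : 𝔸))‖ ≤ 101 / 100 ∧ ‖((holT W (emb c.src) (List.replicate P.L (c.dir, true)) : 𝔸ˣ) : 𝔸)‖ ≤ 101 / 100 ∧
      ‖eml (fun i : Idx P => ((loopHolU W c i : 𝔸ˣ) : 𝔸)) * ((holT W (emb c.src) (List.replicate P.L (c.dir, true)) : 𝔸ˣ) : 𝔸)‖ ≤ 101 / 100 ∧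
      ‖(((dbarAvgU W c)⁻¹ : 𝔸ˣ) : 𝔸)‖ ≤ 101 / 100 := by
  have hℓ0 : (0 : ℝ) ≤ (((P.d + 2) * P.L : ℕ) : ℝ) := Nat.cast_nonneg _
  have hℓ1n : 1 ≤ (P.d + 2) * P.L := Nat.one_le_iff_ne_zero.mpr (Nat.mul_ne_zero (by omega) (by have := P.hL.2; omega))
  have hLℓn : P.L ≤ (P.d + 2) * P.L := by nlinarith
  have hLℓ : (P.L : ℝ) ≤ (((P.d + 2) * P.L : ℕ) : ℝ) := by exact_mod_cast hLℓn
  have hθ0 : 0 ≤ (((P.d + 2) * P.L : ℕ) : ℝ) * s := mul_nonneg hℓ0 hs0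
  have hθ : (((P.d + 2) * P.L : ℕ) : ℝ) * s ≤ 1 / 10000 := by linarith
  have h4 : 4 * (((P.d + 2) * P.L : ℕ) : ℝ) * s ≤ 1 := by linarith
  have h48 : 48 * (((P.d + 2) * P.L : ℕ) : ℝ) * s ≤ 1 := by linarith
  have h600 : 600 * (((P.d + 2) * P.L : ℕ) : ℝ) * s ≤ 1 := by linarith
  have hn : ∀ {X : 𝔸} {t : ℝ}, ‖X - 1‖ ≤ t → ‖X‖ ≤ 1 + t := fun {X t} h => by
    have := norm_le_norm_add_norm_sub' X 1; rw [norm_one] at this; linarith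
  have hWs : ∀ b : PBond P j, blockOf b.src = c.src → blockOf b.tgt = c.src → ‖((W b : 𝔸ˣ) : 𝔸) - 1‖ ≤ s := fun b h1 h2 => hW b (Or.inl h1) (Or.inl h2)
  have hWt : ∀ b : PBond P j, blockOf b.src = c.tgt → blockOf b.tgt = c.tgt → ‖((W b : 𝔸ˣ) : 𝔸) - 1‖ ≤ s := fun b h1 h2 => hW b (Or.inr h1) (Or.inr h2)
  have hV1 := norm_vframeU_sub_one_le (S := W) hj c.src hs0 h600 hWs
  have hV2 := norm_vframeU_sub_one_le (S := W) hj c.tgt hs0 h600 hWt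
  have hE1 : ‖eml (fun i : Idx P => ((loopHolU W c i : 𝔸ˣ) : 𝔸)) - 1‖ ≤ 6 * (4 * (((P.d + 2) * P.L : ℕ) : ℝ) * s) :=
    BlockAveragingPlaquetteBound.norm_eml_sub_one_le_six_mul (fun i => (norm_loopHolU_sub_one_le hj c hs0 h4 hW i).1) (by linarith)
  have hlen : (List.replicate P.L (c.dir, true)).length ≤ (P.d + 2) * P.L := by rw [List.length_replicate]; exact hLℓn
  have hT1 := (norm_holT_sub_one_sub_walkSum_le_of_length_le (S := W) hs0 hℓ1n h4 _ (emb c.src) hlen fun st hst =>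
      hW st.bond (two_block_of_mem_lineWalk hj c hst).1 (two_block_of_mem_lineWalk hj c hst).2).1
  have hEn : ‖eml (fun i : Idx P => ((loopHolU W c i : 𝔸ˣ) : 𝔸))‖ ≤ 1 + 24 * ((((P.d + 2) * P.L : ℕ) : ℝ) * s) := (hn hE1).trans (by linarith)
  have hTn : ‖((holT W (emb c.src) (List.replicate P.L (c.dir, true)) : 𝔸ˣ) : 𝔸)‖ ≤ 1 + 4 * ((((P.d + 2) * P.L : ℕ) : ℝ) * s) :=
    (hn hT1).trans (by linarith)
  refine ⟨(hn (norm_inv_sub_one_le_two_mul hV1 (by linarith))).trans (by linarith), (hn hV2).trans (by linarith), hEn.trans (by linarith),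
    hTn.trans (by linarith), (norm_mul_le _ _).trans ((mul_le_mul hEn hTn (norm_nonneg _) (by positivity)).trans (by nlinarith)), ?_⟩
  have h1 := norm_dbarAvgU_sub_one_le hj c hs0 h48 hW
  have hsq : 3800 * (((P.d + 2) * P.L : ℕ) : ℝ) ^ 2 * s ^ 2 ≤ (((P.d + 2) * P.L : ℕ) : ℝ) * s := by
    have e : 3800 * (((P.d + 2) * P.L : ℕ) : ℝ) ^ 2 * s ^ 2 = (3800 * ((((P.d + 2) * P.L : ℕ) : ℝ) * s)) * ((((P.d + 2) * P.L : ℕ) : ℝ) * s) := by ring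
    rw [e]
    exact (mul_le_mul_of_nonneg_right (by linarith : 3800 * ((((P.d + 2) * P.L : ℕ) : ℝ) * s) ≤ 1) hθ0).trans (by linarith)
  have hLs : (P.L : ℝ) * s ≤ (((P.d + 2) * P.L : ℕ) : ℝ) * s := mul_le_mul_of_nonneg_right hLℓ hs0
  have h2 : ‖((dbarAvgU W c : 𝔸ˣ) : 𝔸) - 1‖ ≤ 2 * ((((P.d + 2) * P.L : ℕ) : ℝ) * s) := h1.trans (by linarith)
  exact (hn (norm_inv_sub_one_le_two_mul h2 (by linarith))).trans (by linarith)

/-- ★ **(B-iii) THE TORUS DOUBLE BAR IS LIPSCHITZ IN THE FIELD ON THE TWO BLOCKS.**  For `𝔸ˣ`-fields `W, W′` on `T^{(j)}` with `‖W(b) − 1‖, ‖W′(b) − 1‖ ≤ s` and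
`‖W′(b) − W(b)‖ ≤ ρ` on every bond with both ends in the two blocks of `c`, and `10⁴·ℓ·s ≤ 1` (`ℓ = (d+2)L`):
`‖U̿(W)(c)⁻¹·U̿(W′)(c) − 1‖ ≤ 2·(ℓ + L + 2m)·ρ`, `m = d·⌊(L−1)∕2⌋` — the double bar `v(c₋)⁻¹·eml{W(loop_i)}·W([y, y+Le_μ])·v(c₊)` (89)∕(0.4) reads `≤ ℓ` bonds per loop
(✓`length_loopWord_le`), `L` on the axis and `≤ m` per frame stair (✓`length_stairWord_le`), each reading `ρ`-Lipschitz (§1), through the `(1+144t)`-Lipschitz `eml` (§2).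
[cite: Balaban1985Averaging, (62) p.28, (89) p.31, Prop. 3 (122)-(125) p.36; Balaban1987RG1, (0.4) p.253] -/
theorem norm_dbarAvgU_inv_mul_sub_one_le (hj : j + 1 ≤ P.m + P.K) {W W' : GaugeField P j 𝔸ˣ} (c : PBond P (j + 1)) {s ρ : ℝ}
    (hs0 : 0 ≤ s) (hρ0 : 0 ≤ ρ) (hℓs : 10000 * (((P.d + 2) * P.L : ℕ) : ℝ) * s ≤ 1)
    (hW : ∀ b : PBond P j, (blockOf b.src = c.src ∨ blockOf b.src = c.tgt) → (blockOf b.tgt = c.src ∨ blockOf b.tgt = c.tgt) →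
      ‖((W b : 𝔸ˣ) : 𝔸) - 1‖ ≤ s)
    (hW' : ∀ b : PBond P j, (blockOf b.src = c.src ∨ blockOf b.src = c.tgt) → (blockOf b.tgt = c.src ∨ blockOf b.tgt = c.tgt) →
      ‖((W' b : 𝔸ˣ) : 𝔸) - 1‖ ≤ s)
    (hd : ∀ b : PBond P j, (blockOf b.src = c.src ∨ blockOf b.src = c.tgt) → (blockOf b.tgt = c.src ∨ blockOf b.tgt = c.tgt) →
      ‖((W' b : 𝔸ˣ) : 𝔸) - W b‖ ≤ ρ) :
    ‖(((dbarAvgU W c)⁻¹ * dbarAvgU W' c : 𝔸ˣ) : 𝔸) - 1‖ ≤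
      2 * ((((P.d + 2) * P.L : ℕ) : ℝ) + P.L + 2 * ((P.d * ((P.L - 1) / 2) : ℕ) : ℝ)) * ρ := by
  have hℓ0 : (0 : ℝ) ≤ (((P.d + 2) * P.L : ℕ) : ℝ) := Nat.cast_nonneg _
  have hm0 : (0 : ℝ) ≤ ((P.d * ((P.L - 1) / 2) : ℕ) : ℝ) := Nat.cast_nonneg _
  have hL0 : (0 : ℝ) ≤ P.L := Nat.cast_nonneg _
  -- block hypotheses at the two ends
  have hWs : ∀ b : PBond P j, blockOf b.src = c.src → blockOf b.tgt = c.src → ‖((W b : 𝔸ˣ) : 𝔸) - 1‖ ≤ s := fun b h1 h2 => hW b (Or.inl h1) (Or.inl h2)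
  have hW's : ∀ b : PBond P j, blockOf b.src = c.src → blockOf b.tgt = c.src → ‖((W' b : 𝔸ˣ) : 𝔸) - 1‖ ≤ s := fun b h1 h2 => hW' b (Or.inl h1) (Or.inl h2)
  have hds : ∀ b : PBond P j, blockOf b.src = c.src → blockOf b.tgt = c.src → ‖((W' b : 𝔸ˣ) : 𝔸) - W b‖ ≤ ρ := fun b h1 h2 => hd b (Or.inl h1) (Or.inl h2)
  have hWt : ∀ b : PBond P j, blockOf b.src = c.tgt → blockOf b.tgt = c.tgt → ‖((W b : 𝔸ˣ) : 𝔸) - 1‖ ≤ s := fun b h1 h2 => hW b (Or.inr h1) (Or.inr h2)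
  have hW't : ∀ b : PBond P j, blockOf b.src = c.tgt → blockOf b.tgt = c.tgt → ‖((W' b : 𝔸ˣ) : 𝔸) - 1‖ ≤ s := fun b h1 h2 => hW' b (Or.inr h1) (Or.inr h2)
  have hdt : ∀ b : PBond P j, blockOf b.src = c.tgt → blockOf b.tgt = c.tgt → ‖((W' b : 𝔸ˣ) : 𝔸) - W b‖ ≤ ρ := fun b h1 h2 => hd b (Or.inr h1) (Or.inr h2)
  -- sizes
  obtain ⟨hV1i, -, hEn, -, hETn, hDinv⟩ := norm_dbar_factors_le hj c hs0 hℓs hW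
  obtain ⟨-, hV2'n, -, hT'n, hE'T'n, -⟩ := norm_dbar_factors_le hj c hs0 hℓs hW'
  -- differences
  have hV2d := norm_vframeU_sub_vframeU_le hj c.tgt hs0 hρ0 hℓs hWt hW't hdt
  have hETd : ‖eml (fun i : Idx P => ((loopHolU W' c i : 𝔸ˣ) : 𝔸)) * ((holT W' (emb c.src) (List.replicate P.L (c.dir, true)) : 𝔸ˣ) : 𝔸) -
      eml (fun i : Idx P => ((loopHolU W c i : 𝔸ˣ) : 𝔸)) * ((holT W (emb c.src) (List.replicate P.L (c.dir, true)) : 𝔸ˣ) : 𝔸)‖ ≤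
      6 / 5 * ((((P.d + 2) * P.L : ℕ) : ℝ) + P.L) * ρ := by
    refine (norm_mul_sub_mul_le' _ _ _ _).trans ?_
    have hEd := norm_eml_loopHolU_sub_le hj c hs0 hρ0 hℓs hW hW' hd
    have hTd := norm_holT_line_sub_le hj c hs0 hρ0 hℓs hW hW' hd
    calc _ ≤ (112 / 100 * (((P.d + 2) * P.L : ℕ) : ℝ) * ρ) * (101 / 100) + (101 / 100) * (21 / 20 * P.L * ρ) := by gcongr
      _ ≤ 6 / 5 * ((((P.d + 2) * P.L : ℕ) : ℝ) + P.L) * ρ := by linarith [mul_nonneg hℓ0 hρ0, mul_nonneg hL0 hρ0]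
  have hVinv : ‖(((vframeU W' c.src)⁻¹ : 𝔸ˣ) : 𝔸) - (((vframeU W c.src)⁻¹ : 𝔸ˣ) : 𝔸)‖ ≤ 6 / 5 * ((P.d * ((P.L - 1) / 2) : ℕ) : ℝ) * ρ := by
    obtain ⟨hV1'i, -, -, -, -, -⟩ := norm_dbar_factors_le hj c hs0 hℓs hW'
    refine (norm_inv_sub_inv_le (vframeU W c.src) (vframeU W' c.src)).trans ?_
    have hV1d := norm_vframeU_sub_vframeU_le hj c.src hs0 hρ0 hℓs hWs hW's hds
    calc _ ≤ (101 / 100) * (112 / 100 * ((P.d * ((P.L - 1) / 2) : ℕ) : ℝ) * ρ) * (101 / 100) := by gcongr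
      _ ≤ 6 / 5 * ((P.d * ((P.L - 1) / 2) : ℕ) : ℝ) * ρ := by linarith [mul_nonneg hm0 hρ0]
  -- conclusion
  rw [Units.val_mul]
  have e : (((dbarAvgU W c)⁻¹ : 𝔸ˣ) : 𝔸) * dbarAvgU W' c - 1 = (((dbarAvgU W c)⁻¹ : 𝔸ˣ) : 𝔸) * (((dbarAvgU W' c : 𝔸ˣ) : 𝔸) - dbarAvgU W c) := by
    rw [mul_sub, Units.inv_mul]
  rw [e, coe_dbarAvgU, coe_dbarAvgU, coe_emlAvgU, coe_emlAvgU]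
  have h := norm_assembly_le hm0 (add_nonneg hℓ0 hL0) hρ0 hDinv hV1i hETn hE'T'n hV2'n hVinv hETd hV2d
  exact h.trans (le_of_eq (by ring))

end DoubleBar

end Summit.QuantumFields.YangMills.Theorems.HalvingDbarLipschitz

end
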